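import Summits.CriticalPhenomena.PercolationContinuityZ3.Theorems.PercNearOneGluingNoHeavyQuantDeficitFAR
import HarnessLib

/-!
# FAR beyond trees: the DEFICIT fixed-set FAR inequality at EVERY layer `j ≥ 2` — `P(N ≥ j+1) ≥ η·(E N − j)/j` for independent
# trials with success probabilities in `[η, 1]` and mean `E N ≤ 2j`

builds on p205010 (kernel theorem, internal audit signed; external expert review pending)

Support file (`--supports stmt-CriticalPhenomena-4575`), seat `prim-cert-1` (gen 41); memo `prim-cert-1/FROM-prim-cert-1-g41-ALL-LAYERS.md` §1.
This is inequality **(D)_j** of `prim-cert-1/FROM-prim-cert-1-g34-UNIVERSAL-WITNESS.md` §3 for a GENERAL layer `j ≥ 2` (gen 35 proved `j = 2`,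
`Quant.CountDP.deficit_far_two`, by a three-way case split special to `j = 2`): the short-row half of THM B ("the weakest-hair bet `W(μ_W)` is a
hair-only certificate for `SunFAR K j` whenever `η(Σh − 2j) ≤ j(F − η)`").  Same local notation `PB[p, m] b` as `…QuantCountDP.lean`
(probability that exactly `b` of the first `m` independent trials succeed); pure real algebra on the recursion, no definitions, no sorries,
standard axioms.

* **`Quant.CountDP.deficit_far`** — for `0 < η`, `η ≤ p k ≤ 1` (`k < m`), `2 ≤ j` and `Σ_{k<m} p k ≤ 2j`:
  `η·(Σ_{k<m} p k − j)/j ≤ 1 − Σ_{i ≤ j} PB[p, m] i` (`= P(S_m ≥ j+1)`).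
  PROOF (two lines, uniform in `j`; `E := Σ p`, `d := E − j`, trivial if `d ≤ 0`):
  (a) `(m − j)·η ≤ j`: MARKOV through the tail sum `E = Σ_{a<m} P(S ≥ a+1) ≤ j + (m − j)·P(S ≥ j+1)`
      (`Quant.CountDP.sum_tail_eq_mean`), so `η d/j ≤ η(m−j)P(S ≥ j+1)/j ≤ P(S ≥ j+1)`;
  (b) `(m − j)·η > j`: then `d ≥ mη − j > jη`, and CANTELLI (`Quant.CountDP.sum_sq_dev`, variance `≤ W := (1−η)E`) gives
      `P(S ≥ j+1)·(d² + W) ≥ d²`, while `η(d² + W) ≤ j d` by the identity `jd − ηd² − η(1−η)(j+d) = ηd(j−d) + (1−η)(d(j−η) − ηj)`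
      (`d ≤ j`, `d(j − η) ≥ d > jη` as `j − η ≥ 1`).  Equality only at the all-sure corner `η = 1`, `E = 2j`.
Numerical re-check (seat folder `work/pb/check_DS.py`: 20 000 random instances `j ≤ 6` incl. the regime assertions): 0 violations.
Nearest prior art: Markov's and Cantelli's inequalities are folklore; the packaged statement is [this work].
-/

noncomputable section

namespace Summit.CriticalPhenomena.PercolationContinuityZ3.Theorems

namespace Quant

namespace CountDP

open Finset

/-- `PB[p, m] b` = probability that exactly `b` of the first `m` independent trials succeed (recursion on `m`, as in `…QuantCountDP.lean`). -/
local notation3 "PB[" p ", " m "]" =>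
  (Nat.rec (motive := fun _ => ℕ → ℝ) (fun b => if b = 0 then (1 : ℝ) else 0)
    (fun n f b => (p : ℕ → ℝ) n * (if b = 0 then (0 : ℝ) else f (b - 1)) + (1 - (p : ℕ → ℝ) n) * f b) (m : ℕ))

variable (p : ℕ → ℝ)

/-- The cdf is monotone in its horizon: `Σ_{i<a} PB[p, m] i ≤ Σ_{i<b} PB[p, m] i` for `a ≤ b`. [folklore] -/
theorem cdf_mono_horizon (hp : ∀ k, 0 ≤ p k ∧ p k ≤ 1) (m : ℕ) {a b : ℕ} (hab : a ≤ b) :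
    ∑ i ∈ Finset.range a, PB[p, m] i ≤ ∑ i ∈ Finset.range b, PB[p, m] i :=
  Finset.sum_le_sum_of_subset_of_nonneg (Finset.range_mono hab) fun i _ _ => PB_nonneg p hp m i

/-- **Markov through the tail sum**: `Σ_{k<m} p k ≤ j + (m − j)·P(S_m ≥ j+1)` for `j ≤ m`. [folklore] -/
theorem mean_le_add_mul_tail (hp : ∀ k, 0 ≤ p k ∧ p k ≤ 1) {m j : ℕ} (hjm : j ≤ m) :
    ∑ k ∈ Finset.range m, p k ≤ j + ((m : ℝ) - j) * (1 - ∑ i ∈ Finset.range (j + 1), PB[p, m] i) := by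
  obtain ⟨n, rfl⟩ : ∃ n, m = j + n := ⟨m - j, by omega⟩
  rw [← sum_tail_eq_mean p (j + n), Finset.sum_range_add]
  have h1 : ∑ a ∈ Finset.range j, (1 - ∑ i ∈ Finset.range (a + 1), PB[p, j + n] i) ≤ j := by
    have := Finset.sum_le_sum (s := Finset.range j) (f := fun a => 1 - ∑ i ∈ Finset.range (a + 1), PB[p, j + n] i)
      (g := fun _ => (1 : ℝ)) fun a _ => by linarith [cdf_nonneg p hp (j + n) (a + 1)]
    simpa using this
  have h2 : ∑ a ∈ Finset.range n, (1 - ∑ i ∈ Finset.range (j + a + 1), PB[p, j + n] i) ≤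
      n * (1 - ∑ i ∈ Finset.range (j + 1), PB[p, j + n] i) := by
    have := Finset.sum_le_sum (s := Finset.range n) (f := fun a => 1 - ∑ i ∈ Finset.range (j + a + 1), PB[p, j + n] i)
      (g := fun _ => 1 - ∑ i ∈ Finset.range (j + 1), PB[p, j + n] i) fun a _ => by
        linarith [cdf_mono_horizon p hp (j + n) (show j + 1 ≤ j + a + 1 by omega)]
    rw [Finset.sum_const, Finset.card_range, nsmul_eq_mul] at this
    exact this
  push_cast
  linarith

/-- **THE DEFICIT FIXED-SET FAR INEQUALITY AT EVERY LAYER `j ≥ 2`.**  For independent trials with success probabilities `η ≤ p k ≤ 1`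
(`k < m`, `η > 0`) and mean `Σ_{k<m} p k ≤ 2j`:  `η·(Σ_{k<m} p k − j)/j ≤ P(S_m ≥ j+1) = 1 − Σ_{i≤j} PB[p, m] i`.
(Markov when `(m−j)η ≤ j`, Cantelli otherwise; the layer-`2` case is `Quant.CountDP.deficit_far_two`.) [this work] -/
theorem deficit_far (hp : ∀ k, 0 ≤ p k ∧ p k ≤ 1) {η : ℝ} (hη0 : 0 < η) {m : ℕ} (hη : ∀ k, k < m → η ≤ p k)
    {j : ℕ} (hj : 2 ≤ j) (hE : ∑ k ∈ Finset.range m, p k ≤ 2 * j) :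
    η * (∑ k ∈ Finset.range m, p k - j) / j ≤ 1 - ∑ i ∈ Finset.range (j + 1), PB[p, m] i := by
  set E := ∑ k ∈ Finset.range m, p k with hEdef
  set C := ∑ i ∈ Finset.range (j + 1), PB[p, m] i with hCdef
  have hC1 : C ≤ 1 := cdf_le_one p hp m (j + 1)
  have hj0 : (0 : ℝ) < j := by exact_mod_cast (show 0 < j by omega)
  have hj2 : (2 : ℝ) ≤ j := by exact_mod_cast hj
  have hEm : E ≤ m := by
    rw [hEdef]
    have := Finset.sum_le_sum (s := Finset.range m) (f := p) (g := fun _ => (1 : ℝ)) fun k _ => (hp k).2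
    simpa using this
  have hEη : (m : ℝ) * η ≤ E := by
    rw [hEdef]
    have := Finset.sum_le_sum (s := Finset.range m) (f := fun _ => η) (g := p) fun k hk => hη k (Finset.mem_range.1 hk)
    simpa using this
  -- the trivial case `E ≤ j`
  by_cases hd : E ≤ j
  · have : η * (E - j) / j ≤ 0 :=
      div_nonpos_of_nonpos_of_nonneg (mul_nonpos_of_nonneg_of_nonpos hη0.le (by linarith)) hj0.le
    linarith
  push Not at hd
  have hjm : j ≤ m := by
    by_contra h
    have : (m : ℝ) ≤ j := by exact_mod_cast (show m ≤ j by omega)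
    linarith
  have hη1 : η ≤ 1 := (hη 0 (by omega)).trans (hp 0).2
  rw [div_le_iff₀ hj0]
  by_cases hA : ((m : ℝ) - j) * η ≤ j
  · ----------------------------------------------------------------
    -- (a) Markov: `E ≤ j + (m − j)(1 − C)` and `(m − j)η ≤ j`
    ----------------------------------------------------------------
    have hmk := mean_le_add_mul_tail p hp hjm
    rw [← hEdef, ← hCdef] at hmk
    have h1C : 0 ≤ 1 - C := by linarith
    calc η * (E - j) ≤ η * (((m : ℝ) - j) * (1 - C)) := mul_le_mul_of_nonneg_left (by linarith) hη0.le
      _ = ((m : ℝ) - j) * η * (1 - C) := by ring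
      _ ≤ j * (1 - C) := mul_le_mul_of_nonneg_right hA h1C
      _ = (1 - C) * j := by ring
  · ----------------------------------------------------------------
    -- (b) Cantelli: `C·(d+u)² ≤ u² + Var ≤ u² + (1−η)E` with `u = W/d`, then `η(d² + W) ≤ j d`
    ----------------------------------------------------------------
    push Not at hA
    set d := E - j with hddef
    have hd0 : 0 < d := by rw [hddef]; linarith
    have hdj : d ≤ j := by rw [hddef]; linarith
    have hdη : j * η < d := by rw [hddef]; nlinarith
    set W := (1 - η) * E with hWdef
    have hW0 : 0 ≤ W := mul_nonneg (by linarith) (by linarith)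
    have hvar : ∑ k ∈ Finset.range m, p k * (1 - p k) ≤ W := by
      rw [hWdef, hEdef, Finset.mul_sum]
      exact Finset.sum_le_sum fun k hk => by
        have := hη k (Finset.mem_range.1 hk)
        nlinarith [(hp k).1]
    have hmarkov : ∀ u : ℝ, 0 ≤ u → C * (d + u) ^ 2 ≤ ∑ b ∈ Finset.range (m + 1), (E + u - b) ^ 2 * PB[p, m] b := by
      intro u hu
      calc C * (d + u) ^ 2 = ∑ i ∈ Finset.range (j + 1), (d + u) ^ 2 * PB[p, m] i := by
            rw [hCdef, Finset.sum_mul]; exact Finset.sum_congr rfl fun i _ => by ring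
        _ ≤ ∑ i ∈ Finset.range (j + 1), (E + u - i) ^ 2 * PB[p, m] i := by
            refine Finset.sum_le_sum fun i hi => mul_le_mul_of_nonneg_right ?_ (PB_nonneg p hp m i)
            have hij : (i : ℝ) ≤ j := by exact_mod_cast (show i ≤ j by rw [Finset.mem_range] at hi; omega)
            have h1 : d + u ≤ E + u - i := by rw [hddef]; linarith
            exact pow_le_pow_left₀ (by linarith) h1 2
        _ ≤ ∑ b ∈ Finset.range (m + 1), (E + u - b) ^ 2 * PB[p, m] b := by
            rcases Nat.lt_or_ge m j with hmj | hmj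
            · exact absurd hjm (by omega)
            · exact Finset.sum_le_sum_of_subset_of_nonneg (Finset.range_mono (by omega))
                fun b _ _ => mul_nonneg (sq_nonneg _) (PB_nonneg p hp m b)
    have hcant : ∀ u : ℝ, 0 ≤ u → C * (d + u) ^ 2 ≤ u ^ 2 + W := by
      intro u hu
      have h1 := hmarkov u hu
      rw [sum_sq_dev p m (E + u), ← hEdef] at h1
      have e : (E + u - E) ^ 2 = u ^ 2 := by ring
      rw [e] at h1
      linarith
    -- `u = W/d`:  `C (d² + W)² ≤ W (d² + W)`, hence `(1 − C)(d² + W) ≥ d²`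
    have hkey : d ^ 2 ≤ (1 - C) * (d ^ 2 + W) := by
      have h1 := hcant (W / d) (div_nonneg hW0 hd0.le)
      have e1 : d + W / d = (d ^ 2 + W) / d := by field_simp
      rw [e1, div_pow] at h1
      have hd2 : 0 < d ^ 2 := by positivity
      have h2 : C * (d ^ 2 + W) ^ 2 ≤ (W / d) ^ 2 * d ^ 2 + W * d ^ 2 := by
        have := mul_le_mul_of_nonneg_right h1 hd2.le
        rwa [mul_div_assoc', div_mul_cancel₀ _ hd2.ne', add_mul] at this
      have e2 : (W / d) ^ 2 * d ^ 2 = W ^ 2 := by field_simp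
      rw [e2] at h2
      have hS : 0 < d ^ 2 + W := by positivity
      have h3 : C * (d ^ 2 + W) ≤ W := by
        have : C * (d ^ 2 + W) * (d ^ 2 + W) ≤ W * (d ^ 2 + W) := by nlinarith
        exact le_of_mul_le_mul_right this hS
      nlinarith
    -- the algebra `η (d² + W) ≤ j d`
    have halg : η * (d ^ 2 + W) ≤ j * d := by
      have hjη : (1 : ℝ) ≤ j - η := by linarith
      have e : j * d - η * (d ^ 2 + W) = η * d * (j - d) + (1 - η) * (d * (j - η) - η * j) := by
        rw [hWdef, show E = j + d by rw [hddef]; ring]; ring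
      have h1 : 0 ≤ η * d * (j - d) := mul_nonneg (mul_nonneg hη0.le hd0.le) (by linarith)
      have h2 : 0 ≤ d * (j - η) - η * j := by nlinarith
      have h3 : 0 ≤ (1 - η) * (d * (j - η) - η * j) := mul_nonneg (by linarith) h2
      linarith
    -- combine: `η d (d² + W) ≤ j d² ≤ j (1 − C)(d² + W)`
    have hS : 0 < d ^ 2 + W := by positivity
    have h1 : η * d * (d ^ 2 + W) ≤ (1 - C) * j * (d ^ 2 + W) := by nlinarith
    have h2 : η * d ≤ (1 - C) * j := le_of_mul_le_mul_right h1 hS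
    linarith

end CountDP

end Quant

end Summit.CriticalPhenomena.PercolationContinuityZ3.Theorems

end
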